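import Literature.NumberTheory.LFunctions.FordLemma32D
import HarnessLib

/-!
# Ford's Lemma 3.2 for systems of general type `(d,T)` (the "fundamental lemma")

Topic `Literature/NumberTheory/LFunctions`. Everything here is PROVED.

K. Ford, Proc. LMS 85 (2002), Lemma 3.2, assembled from `FordLemma32A`–`FordLemma32D`:
for a system `Ψ` of type `(d,T)`, `s = d + e ≥ 1`, `d + 1 ≤ r ≤ k`, `P > 4k⁴`, a set `𝒫` of primes
`> k` with `T (P−1)^{(k−d)(k−d−1)} < ∏ 𝒫` and `16 s² p ≤ Q` for `p ∈ 𝒫`, there are `p ∈ 𝒫` and a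
system `Φ` of type `(d,T)` with
`K_s(P,Q;Ψ;q) ≤ 4 |𝒫| k! p^{2s + C(r,2) + C(d,2)} L_s(P,⌊Q/p⌋;Φ;p,q,r)` (note
`C(r,2) + C(d,2) = (r²−r+d²−d)/2`; `FordVK.ford_lemma32`; Ford has `|𝒫| = k³`, `32 s² M < Q`).

## References

* K. Ford, Proc. London Math. Soc. (3) 85 (2002), 565–633, Lemma 3.2. [Ford2002]
-/

noncomputable section

open Finset MeasureTheory Polynomial Complex
open scoped Real ComplexConjugate

namespace Literature.NumberTheory.LFunctions
namespace FordVK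

open VMV

/-! ### Small pieces -/

/-- `n.choose 2 * 2 = n (n−1)`. [folklore] -/
theorem choose_two_mul_two (n : ℕ) : n.choose 2 * 2 = n * (n - 1) := by
  rw [Nat.choose_two_right]
  exact Nat.div_mul_cancel (Nat.even_mul_pred_self n).two_dvd

/-- The exponent sum `∑_{c<n} (r − min(d+c+1, r)) = C(r−d, 2)` for `d+1 ≤ r ≤ n+d`. [cite: Ford2002, proof
of Lemma 3.2 ("there are p^{max(0,r−j)} possibilities for m_j modulo p^r")] -/
theorem sum_r_sub_min (d r n : ℕ) (h1 : d + 1 ≤ r) (h2 : r ≤ n + d) :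
    ∑ c ∈ range n, (r - min (d + c + 1) r) = (r - d).choose 2 := by
  set N := r - d - 1 with hN
  have hsplit : ∑ c ∈ range n, (r - min (d + c + 1) r) = ∑ c ∈ range N, (r - min (d + c + 1) r) := by
    have hNn : N ≤ n := by omega
    rw [← sum_range_add_sum_Ico _ hNn]
    have h0 : ∑ c ∈ Finset.Ico N n, (r - min (d + c + 1) r) = 0 :=
      sum_eq_zero fun c hc => by rw [Finset.mem_Ico] at hc; omega
    rw [h0, add_zero]
  rw [hsplit]
  have h3 : ∑ c ∈ range N, (r - min (d + c + 1) r) = ∑ c ∈ range N, (c + 1) := by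
    rw [← sum_range_reflect (fun c => c + 1) N]
    refine sum_congr rfl fun c hc => ?_
    rw [mem_range] at hc; omega
  rw [h3]
  have h4 : ∑ c ∈ range N, (c + 1) = ∑ i ∈ range (N + 1), i := by
    rw [Finset.sum_range_succ']; simp
  rw [h4]
  have h5 := Finset.sum_range_id_mul_two (N + 1)
  have h6 := choose_two_mul_two (r - d)
  have e : r - d = N + 1 := by omega
  rw [e] at h6 ⊢
  omega

/-- `Z̃` is unchanged under translation of the system. [cite: Ford2002, proof of Lemma 3.2 ("By Lemma 3.1,
J_{k−d}(z;Ψ) = J_{k−d}(z;Φ)")] -/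
theorem Zt_transl {k : ℕ} (P : ℕ) {Ψ : PSystem k} {d T m : ℕ} (hΨ : IsType Ψ d T m) (hT : T ≠ 0) (c : ℤ)
    (n : ℕ) (hnd : n + d ≤ k) (p : ℕ) : Zt P (transl c Ψ) d n hnd p = Zt P Ψ d n hnd p := by
  unfold Zt
  refine filter_congr fun z _ => ?_
  rw [jac_transl hΨ hT c hnd]

/-- `Sol6'(c) = S6count` for `Φ = transl (c̃q) Ψ`, `Q' = ⌊Q/p⌋`. [folklore] -/
theorem card_Sol6'_eq {k : ℕ} (s P Q : ℕ) {Ψ : PSystem k} {d T m : ℕ} (hΨ : IsType Ψ d T m) (hT : T ≠ 0)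
    (q : ℤ) (n : ℕ) (hnd : n + d ≤ k) (p : ℕ) (c : ℤ) :
    (Sol6' s P Q Ψ q d n hnd p c).card = S6count s P (Q / p) (transl (ctil p c * q) Ψ) q d n hnd p := by
  rw [Sol6', S6count, A6, Zt_transl P hΨ hT _ n hnd p]

/-! ### The maximiser -/

/-- A system of type `(d,T)` maximising `K_s` over all systems of type `(d,T)` (any `m`). [cite: Ford2002,
proof of Lemma 3.2 ("there is a system Ψ₀ ∈ W so that K_s(P,Q;Ψ₀;q) = max_{Ψ∈W} K_s(P,Q;Ψ;q)")] -/
theorem exists_maximiser {k : ℕ} (s P Q : ℕ) (q : ℤ) (d T : ℕ) (Ψ : PSystem k) (m : ℕ) (hΨ : IsType Ψ d T m) :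
    ∃ Ψ₀ : PSystem k, (∃ m₀, IsType Ψ₀ d T m₀) ∧
      ∀ Ψ' : PSystem k, (∃ m', IsType Ψ' d T m') → Ks s P Q Ψ' q ≤ Ks s P Q Ψ₀ q := by
  classical
  have hne : ({v | ∃ Ψ' : PSystem k, (∃ m', IsType Ψ' d T m') ∧ Ks s P Q Ψ' q = v} : Set ℕ).Nonempty :=
    ⟨Ks s P Q Ψ q, Ψ, ⟨m, hΨ⟩, rfl⟩
  have hbdd : BddAbove ({v | ∃ Ψ' : PSystem k, (∃ m', IsType Ψ' d T m') ∧ Ks s P Q Ψ' q = v} : Set ℕ) :=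
    ⟨P ^ (2 * k) * Q ^ (2 * s), fun v hv => by obtain ⟨Ψ', -, rfl⟩ := hv; exact Ks_le s P Q Ψ' q⟩
  obtain ⟨Ψ₀, hΨ₀, hmax⟩ := Nat.sSup_mem hne hbdd
  refine ⟨Ψ₀, hΨ₀, fun Ψ' hΨ' => ?_⟩
  rw [hmax]
  exact le_csSup hbdd ⟨Ψ', hΨ', rfl⟩

/-! ### Lemma 3.2 -/

set_option maxHeartbeats 1600000 in
/-- **Ford's Lemma 3.2 (general `d`, explicit primes).** Let `k = k'+2`, `s = d+e ≥ 1`,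
`d + 1 ≤ r ≤ k`, `P > 4k⁴`, `Q ≥ 1`, `q ≠ 0`, `Ψ` of type `(d,T)` with `T ≥ 1`, and let `𝒫` be a
nonempty set of primes `> k` with `T (P−1)^{(k−d)(k−d−1)} < ∏ 𝒫` and `16 s² p ≤ Q` for all `p ∈ 𝒫`.
Then for some `p ∈ 𝒫` and some system `Φ` of type `(d,T)`,
`K_s(P,Q;Ψ;q) ≤ 4 |𝒫| k! p^{2s + C(r,2) + C(d,2)} L_s(P,⌊Q/p⌋;Φ;p,q,r)` (`C(r,2)+C(d,2) = (r²−r+d²−d)/2`).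
[cite: Ford2002, Lemma 3.2 (with `|𝒫| = k³`)] -/
theorem ford_lemma32 {k' d e r : ℕ} (hs : 1 ≤ d + e) (hr : d + 1 ≤ r) (hrk : r ≤ k' + 2)
    (P Q : ℕ) (hP : 4 * (k' + 2) ^ 4 < P) (hQ : 1 ≤ Q) {q : ℤ} (hq : q ≠ 0)
    (Ψ : PSystem (k' + 2)) {T m : ℕ} (hΨ : IsType Ψ d T m) (hT : 1 ≤ T)
    (Ps : Finset ℕ) (hPs : ∀ p ∈ Ps, p.Prime ∧ k' + 2 < p) (hne : Ps.Nonempty)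
    (hprod : T * (P - 1) ^ ((k' + 2 - d) * (k' + 2 - d - 1)) < ∏ p ∈ Ps, p)
    (hQp : ∀ p ∈ Ps, 16 * (d + e) ^ 2 * p ≤ Q) :
    ∃ p ∈ Ps, ∃ Φ : PSystem (k' + 2), (∃ m', IsType Φ d T m') ∧
      Ks (d + e) P Q Ψ q ≤ 4 * Ps.card * (k' + 2).factorial * p ^ (2 * (d + e) + ((r.choose 2) + d.choose 2))
        * Ls (d + e) P (Q / p) Φ p q r := by
  classical
  have hdk : d ≤ k' + 2 := by omega
  have hnd : (k' + 2 - d) + d ≤ k' + 2 := by omega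
  have hT0 : T ≠ 0 := by omega
  -- the maximiser
  obtain ⟨Ψ₀, ⟨m₀, hΨ₀⟩, hmax⟩ := exists_maximiser (d + e) P Q q d T Ψ m hΨ
  have hK0 : Ks (d + e) P Q Ψ q ≤ Ks (d + e) P Q Ψ₀ q := hmax Ψ ⟨m, hΨ⟩
  -- `K ≤ 2 S₁`
  have h2S1 := Ks_le_two_S1 (d + e) P Q Ψ₀ hq hQ hP (hmax _ ⟨m₀ + 1, hΨ₀.double⟩)
  -- `S₁ ≤ ∑_p S₃(p)`
  have hS13 := card_Sol1_le_sum_Sol3 (d + e) P Q Ψ₀ q d (k' + 2 - d) hnd hΨ₀ hT (by omega) hPs hprod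
  -- choose the worst prime
  obtain ⟨p, hp, hpmax⟩ := exists_max_image Ps (fun p => (Sol3 (d + e) P Q Ψ₀ q d (k' + 2 - d) hnd p).card) hne
  have hsum : ∑ p' ∈ Ps, (Sol3 (d + e) P Q Ψ₀ q d (k' + 2 - d) hnd p').card
      ≤ Ps.card * (Sol3 (d + e) P Q Ψ₀ q d (k' + 2 - d) hnd p).card := by
    calc ∑ p' ∈ Ps, (Sol3 (d + e) P Q Ψ₀ q d (k' + 2 - d) hnd p').card
        ≤ ∑ _p' ∈ Ps, (Sol3 (d + e) P Q Ψ₀ q d (k' + 2 - d) hnd p).card := sum_le_sum hpmax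
      _ = _ := by rw [sum_const, smul_eq_mul]
  have hpP := (hPs p hp).1
  have hpk := (hPs p hp).2
  haveI : Fact p.Prime := ⟨hpP⟩
  have hp0 : 0 < p := hpP.pos
  -- choose the worst class `c`
  obtain ⟨c, -, hcmax⟩ := exists_max_image (Finset.Ico (0 : ℤ) p) (fun c => S4 (d + e) P Q Ψ₀ q d (k' + 2 - d) hnd p c)
    ⟨0, by rw [Finset.mem_Ico]; exact ⟨le_rfl, by exact_mod_cast hp0⟩⟩
  -- `S₃(p) ≤ d! p^e (p^s S₄(c))`
  have hS3 := card_Sol3_le (d + e) P Q Ψ₀ q d (k' + 2 - d) hnd p (e := e) rfl (by omega) hs hΨ₀ hq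
    (M := S4 (d + e) P Q Ψ₀ q d (k' + 2 - d) hnd p c) hcmax
  -- `S₄(c) ≤ 2 S₆'(c)`
  obtain ⟨s', hs'⟩ : ∃ s', d + e = s' + 1 := ⟨d + e - 1, by omega⟩
  have hS46 : S4 (d + e) P Q Ψ₀ q d (k' + 2 - d) hnd p c ≤ 2 * (Sol6' (d + e) P Q Ψ₀ q d (k' + 2 - d) hnd p c).card := by
    have h := S4_le_two_S6' P Q Ψ₀ q d (k' + 2 - d) hnd p c (s' := s') hp0 (by rw [← hs']; exact hQp p hp)
    rw [← hs'] at h; exact h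
  -- `S₆'(c) ≤ N · L_s`
  have hΦt : IsType (transl (ctil p c * q) Ψ₀) d T m₀ := hΨ₀.transl hT0 _
  have hS6 := card_Sol6'_eq (d + e) P Q hΨ₀ hT0 q (k' + 2 - d) hnd p c
  have hr1 : 1 ≤ r := by omega
  have hB := fun mm => card_Bstar_le (transl (ctil p c * q) Ψ₀) d (k' + 2 - d) hnd p r hΦt hr1 mm
  have hSL := S6count_le (d + e) P (Q / p) (transl (ctil p c * q) Ψ₀) q d (k' + 2 - d) hnd p r hp0 hr1 hB
  -- the constant `N`
  have hkn : k' + 2 - (k' + 2 - d) = d := by omega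
  have hprodexp : ∏ c : Fin (k' + 2 - d), p ^ (r - min (d + c.val + 1) r) = p ^ ((r - d).choose 2) := by
    rw [Finset.prod_pow_eq_pow_sum, Fin.sum_univ_eq_sum_range (fun c => r - min (d + c + 1) r) (k' + 2 - d),
      sum_r_sub_min d r (k' + 2 - d) hr (by omega)]
  rw [hkn, hprodexp] at hSL
  -- assemble
  refine ⟨p, hp, transl (ctil p c * q) Ψ₀, ⟨m₀, hΦt⟩, ?_⟩
  have hfact : d.factorial * (k' + 2 - d).factorial ≤ (k' + 2).factorial :=
    Nat.le_of_dvd (Nat.factorial_pos _) (Nat.factorial_mul_factorial_dvd_factorial hdk)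
  -- exponent bookkeeping: `e + s + r d + C(r−d,2) = 2s + C(r,2) + C(d,2)`
  have hexp : p ^ e * p ^ (d + e) * ((p ^ r) ^ d * p ^ ((r - d).choose 2))
      = p ^ (2 * (d + e) + (r.choose 2 + d.choose 2)) := by
    rw [← pow_mul, ← pow_add, ← pow_add, ← pow_add]
    congr 1
    obtain ⟨ρ, rfl⟩ : ∃ ρ, r = d + 1 + ρ := ⟨r - (d + 1), by omega⟩
    rw [show d + 1 + ρ - d = ρ + 1 by omega]
    have h1 := choose_two_mul_two (ρ + 1)
    have h2 := choose_two_mul_two (d + 1 + ρ)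
    have h3 := choose_two_mul_two d
    rw [show ρ + 1 - 1 = ρ by omega] at h1
    rw [show d + 1 + ρ - 1 = d + ρ by omega] at h2
    rcases Nat.eq_zero_or_pos d with hd0 | hdpos
    · subst hd0; simp at h3 ⊢; nlinarith [h1, h2]
    · obtain ⟨d', rfl⟩ : ∃ d', d = d' + 1 := ⟨d - 1, by omega⟩
      rw [show d' + 1 - 1 = d' by omega] at h3
      nlinarith [h1, h2, h3]
  calc Ks (d + e) P Q Ψ q ≤ Ks (d + e) P Q Ψ₀ q := hK0
    _ ≤ 2 * (Sol1 (d + e) P Q Ψ₀ q).card := h2S1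
    _ ≤ 2 * (Ps.card * (Sol3 (d + e) P Q Ψ₀ q d (k' + 2 - d) hnd p).card) := Nat.mul_le_mul_left 2 (hS13.trans hsum)
    _ ≤ 2 * (Ps.card * (d.factorial * p ^ e * (p ^ (d + e) * (2 * (((k' + 2 - d).factorial
          * ((p ^ r) ^ d * p ^ ((r - d).choose 2))) * Ls (d + e) P (Q / p) (transl (ctil p c * q) Ψ₀) p q r))))) := by
        gcongr
        refine hS3.trans ?_
        gcongr
        exact hS46.trans (by rw [hS6]; exact Nat.mul_le_mul_left 2 hSL)
    _ = 4 * Ps.card * (d.factorial * (k' + 2 - d).factorial) * (p ^ e * p ^ (d + e) * ((p ^ r) ^ d * p ^ ((r - d).choose 2)))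
          * Ls (d + e) P (Q / p) (transl (ctil p c * q) Ψ₀) p q r := by ring
    _ ≤ 4 * Ps.card * (k' + 2).factorial * p ^ (2 * (d + e) + (r.choose 2 + d.choose 2))
          * Ls (d + e) P (Q / p) (transl (ctil p c * q) Ψ₀) p q r := by
        rw [hexp]; gcongr

end FordVK
end Literature.NumberTheory.LFunctions
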